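import Literature.NumberTheory.PAdicHodge.AinfRamifiedTorsionLift
import Literature.NumberTheory.PAdicHodge.AinfRamifiedVarpi
import Literature.NumberTheory.GaloisRepresentations.LubinTateColeman
import Mathlib.RingTheory.Jacobson.Ideal
import HarnessLib

/-!
# (L2′) over the ramified base: a `p`-torsion point of `Ŵ(𝔫_𝒪)` vanishes when `[p] = p·X·R + X^{p²}·S` with `R(0)`, `S(0)` units

Topic `Literature/NumberTheory/PAdicHodge`; THEOREMS ONLY. Assembly of `AinfRamifiedTorsionLift` (`mulP W` on `Ŵ(𝔫_𝒪)` for `W` over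
`𝒪_D = ℤ_p[ϖ]`), `AinfRamifiedTopology` (`𝔫_𝒪 ⊂ A_inf(𝒪)`, `𝔦 = (p, ω)`-adic completeness) and `AinfRamifiedVarpi` (the `ϖ`-adic
descent lemma). The ramified replacement of §2 (L2) of `AinfWeierstrassOmegaPeriodNonvanishing`:

* §1 `𝔫_𝒪` lies in the Jacobson radical of `A_inf(𝒪)` (`mem_jacobson_of_mem_nilTheta`: `aᴺ ∈ 𝔦`, `𝔦 ⊆ Jac` by completeness,
  `Jac` is radical); hence `u + a·y` is a unit for `u ∈ 𝒪_Dˣ`, `a ∈ 𝔫_𝒪` (`isUnit_algebraMap_add_mul`), and the value `R(a)` of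
  a series with unit constant term at a point of `𝔫_𝒪` is a unit (`isUnit_evalAt_of_isUnit_constantCoeff`).
* §2 **`eq_zero_of_mulP_eq_zero`**: if the multiplication-by-`p` series of `W` has the SUPERSINGULAR SHAPE
  `[p](X) = p·X·R(X) + X^{p²}·S(X)` with `R(0)`, `S(0) ∈ 𝒪_Dˣ` (exact height `2`; the coefficient-side input, Silverman AEC IV.7.5
  at `a_p = 0`) and `e + 2 ≤ p²`, then every `T ∈ Ŵ(𝔫_𝒪)` with `[p]T = 0` is `0`: `0 = p·T·R(T) + T^{p²}·S(T)` with
  `R(T)`, `S(T)` units, and the `ϖ`-adic descent lemma applies. Over the UNRAMIFIED base this was `T^{p²} ∈ p𝔸_inf ⇒ T ∈ p𝔸_inf`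
  (reducedness of `𝒪_C♭`) followed by a valuation witness; over the ramified base the descent replaces both.

No definitions, no named facts, no `sorry`. BSD / K★: the ring-side half of the non-vanishing (N1′) of the ω-period on the
potentially supersingular cells; nothing about elliptic curves over number fields is proved here.

## References
* J. H. Silverman, *The Arithmetic of Elliptic Curves* (2009), IV.7.5 (height of `Ê` at supersingular reduction). [SilvermanAEC2009]
* L. Fargues, J.-M. Fontaine, Astérisque 406 (2018), §2.2. [FarguesFontaine2018]
* J.-M. Fontaine, Astérisque 223 (1994), Exp. II §1.3. [FontaineAsterisque223III]
-/

noncomputable section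

open Ideal Field ValuativeRel

namespace Literature.NumberTheory.PAdicHodge

open Literature.NumberTheory.GaloisRepresentations
open Literature.NumberTheory.GaloisRepresentations.IsNonarchimedeanLocalField
open Literature.NumberTheory.GaloisRepresentations.LubinTate

namespace AinfRamTop

variable {F : Type} [Field F] [ValuativeRel F] [TopologicalSpace F] [IsNonarchimedeanLocalField F] [CharZero F]
  {p : ℕ} [Fact p.Prime] [Fact (¬ IsUnit (p : integerC F))] [IsAdicComplete (Ideal.span {(p : integerC F)}) (integerC F)]
  {hp : valuation F p < 1} {D : EisensteinRoot F p hp}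
  {hθ : Function.Surjective (WittVector.fontaineTheta (integerC F) p)}

/-! ## §1 `𝔫_𝒪 ⊆ Jac(A_inf(𝒪))`; values of series with unit constant term are units -/

/-- `𝔦 = (p, ω)` lies in the Jacobson radical of `A_inf(𝒪)` (`𝔦`-adic completeness). [cite: FontaineAsterisque223III, Exp. II §1.3.2] -/
theorem ideal_le_jacobson : (WithIdeal.i : Ideal (AinfRamTop D)) ≤ (⊥ : Ideal (AinfRamTop D)).jacobson := by
  haveI := isAdicComplete_ideal D
  exact IsAdicComplete.le_jacobson_bot _

/-- **`𝔫_𝒪 ⊆ Jac(A_inf(𝒪))`**: an element `a` with `‖θ_𝒪(a)‖ < 1` has a power in `𝔦 ⊆ Jac`, and `Jac` is radical.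
[cite: FontaineAsterisque223III, Exp. II §1.3.2] -/
theorem mem_jacobson_of_mem_nilTheta {a : AinfRamTop D} (ha : a ∈ (nilTheta D hθ).toIdeal) :
    a ∈ (⊥ : Ideal (AinfRamTop D)).jacobson := by
  obtain ⟨N, hN⟩ := exists_pow_mem_ideal_of_norm_lt_one hθ ha
  exact (Ideal.isRadical_jacobson ⊥) ⟨N, ideal_le_jacobson hN⟩

/-- **`c + a·y` is a unit** for `c ∈ 𝒪_Dˣ`, `a ∈ 𝔫_𝒪`. [cite: FontaineAsterisque223III, Exp. II §1.3.2] -/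
theorem isUnit_algebraMap_add_mul {c : EisensteinRoot.CoeffDisc D} (hc : IsUnit c) {a : AinfRamTop D}
    (ha : a ∈ (nilTheta D hθ).toIdeal) (y : AinfRamTop D) :
    IsUnit (algebraMap (EisensteinRoot.CoeffDisc D) (AinfRamTop D) c + a * y) := by
  obtain ⟨v, hv⟩ := hc.map (algebraMap (EisensteinRoot.CoeffDisc D) (AinfRamTop D))
  have h := Ideal.mem_jacobson_bot.1 (mem_jacobson_of_mem_nilTheta ha) (y * (v⁻¹ : (AinfRamTop D)ˣ))
  have h1 : (v : AinfRamTop D) * (v⁻¹ : (AinfRamTop D)ˣ) = 1 := Units.mul_inv v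
  have h2 : algebraMap (EisensteinRoot.CoeffDisc D) (AinfRamTop D) c + a * y = v * (a * (y * (v⁻¹ : (AinfRamTop D)ˣ)) + 1) := by
    rw [← hv]; linear_combination (-(a * y)) * h1
  rw [h2]
  exact (Units.isUnit v).mul h

/-- `evalAt a X = a` on `𝔫_𝒪`. [cite: CasselsFrohlichANT1967, Ch. VI §3.2] -/
theorem evalAt_nilTheta_X (a : (nilTheta D hθ).toIdeal) :
    evalAt (nilTheta D hθ) a (PowerSeries.X : PowerSeries (EisensteinRoot.CoeffDisc D)) = (a : AinfRamTop D) := by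
  rw [← coe_evalPt₁_eq_evalAt (nilTheta D hθ) PowerSeries.X PowerSeries.constantCoeff_X a]
  exact congrArg Subtype.val (evalPt_X (nilTheta D hθ) () (fun _ => a))

/-- `evalAt a (C c) = c`. [cite: CasselsFrohlichANT1967, Ch. VI §3.2] -/
theorem evalAt_nilTheta_C (a : (nilTheta D hθ).toIdeal) (c : EisensteinRoot.CoeffDisc D) :
    evalAt (nilTheta D hθ) a (PowerSeries.C c) = algebraMap (EisensteinRoot.CoeffDisc D) (AinfRamTop D) c := by
  rw [PowerSeries.C_eq_algebraMap, AlgHom.commutes]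

/-- **`R(a) = R(0) + a · R₁(a)`**: the value of a series at a point of `𝔫_𝒪` is its constant term plus a multiple of the point.
[cite: CasselsFrohlichANT1967, Ch. VI §3.2] -/
theorem evalAt_eq_algebraMap_add_mul (a : (nilTheta D hθ).toIdeal) (R : PowerSeries (EisensteinRoot.CoeffDisc D)) :
    evalAt (nilTheta D hθ) a R = algebraMap (EisensteinRoot.CoeffDisc D) (AinfRamTop D) (PowerSeries.constantCoeff R) +
      (a : AinfRamTop D) * evalAt (nilTheta D hθ) a (PowerSeries.mk fun n => PowerSeries.coeff (n + 1) R) := by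
  conv_lhs => rw [PowerSeries.eq_X_mul_shift_add_const R]
  rw [map_add, map_mul, evalAt_nilTheta_X, evalAt_nilTheta_C, add_comm]

/-- **The value at a point of `𝔫_𝒪` of a series with unit constant term is a unit.** [cite: CasselsFrohlichANT1967, Ch. VI §3.2] -/
theorem isUnit_evalAt_of_isUnit_constantCoeff (a : (nilTheta D hθ).toIdeal) {R : PowerSeries (EisensteinRoot.CoeffDisc D)}
    (hR : IsUnit (PowerSeries.constantCoeff R)) : IsUnit (evalAt (nilTheta D hθ) a R) := by
  rw [evalAt_eq_algebraMap_add_mul]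
  exact isUnit_algebraMap_add_mul hR a.2 _

/-! ## §2 `[p]T = 0 ⟹ T = 0` under the supersingular shape of `[p]` -/

variable (W : WeierstrassCurve (EisensteinRoot.CoeffDisc D))

/-- **`[p](a) = p·a·R(a) + a^{p²}·S(a)` on points of `𝔫_𝒪`**, for `[p] = p·X·R + X^{p²}·S`. [cite: SilvermanAEC2009, IV.7.5] -/
theorem coe_mulP_eq_of_shape {R S : PowerSeries (EisensteinRoot.CoeffDisc D)}
    (hshape : W.formalMul p = (p : PowerSeries (EisensteinRoot.CoeffDisc D)) * PowerSeries.X * R + PowerSeries.X ^ (p ^ 2) * S)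
    (a : (nilTheta D hθ).toIdeal) :
    (mulP W a : AinfRamTop D) =
      (p : AinfRamTop D) * a * evalAt (nilTheta D hθ) a R + (a : AinfRamTop D) ^ (p ^ 2) * evalAt (nilTheta D hθ) a S := by
  rw [mulP, coe_evalPt₁_eq_evalAt, hshape, map_add, map_mul, map_mul, map_mul, map_pow, map_natCast, evalAt_nilTheta_X]

/-- **(L2′) `[p]T = 0 ⟹ T = 0` on `Ŵ(𝔫_𝒪)` at supersingular reduction over the ramified base.** If
`[p](X) = p·X·R(X) + X^{p²}·S(X)` with `R(0), S(0) ∈ 𝒪_Dˣ` and `e + 2 ≤ p²`, then a point `T ∈ Ŵ(𝔫_𝒪)` with `[p]T = 0`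
vanishes: `p·T·R(T) = T^{p²}·(−S(T))` with `R(T)`, `S(T)` units, and the `ϖ`-adic descent lemma
(`AinfRam.eq_zero_of_natCast_mul_eq_pow_mul`) gives `T = 0`. [cite: SilvermanAEC2009, IV.7.5] [cite: FarguesFontaine2018, §2.2] -/
theorem eq_zero_of_mulP_eq_zero {R S : PowerSeries (EisensteinRoot.CoeffDisc D)}
    (hshape : W.formalMul p = (p : PowerSeries (EisensteinRoot.CoeffDisc D)) * PowerSeries.X * R + PowerSeries.X ^ (p ^ 2) * S)
    (hR : IsUnit (PowerSeries.constantCoeff R)) (hS : IsUnit (PowerSeries.constantCoeff S)) (he : D.e + 2 ≤ p ^ 2)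
    {T : (nilTheta D hθ).toIdeal} (hT : (mulP W T : AinfRamTop D) = 0) : (T : AinfRamTop D) = 0 := by
  have h1 := coe_mulP_eq_of_shape W hshape T
  rw [hT] at h1
  have h2 : (p : AinfRamTop D) * T * evalAt (nilTheta D hθ) T R =
      (T : AinfRamTop D) ^ (p ^ 2) * (-evalAt (nilTheta D hθ) T S) := by
    rw [mul_neg, eq_neg_iff_add_eq_zero, ← h1]
  exact AinfRam.eq_zero_of_natCast_mul_eq_pow_mul D hθ (T := (of D).symm T)
    (isUnit_evalAt_of_isUnit_constantCoeff T hR) (isUnit_evalAt_of_isUnit_constantCoeff T hS).neg he h2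

/-- **Corollary for Tate-module points**: under the supersingular shape, if Fontaine's element `[τ]` of a `[p]`-compatible
sequence `τ` is killed by `[p]` in `Ŵ(𝔫_𝒪)` then `[τ] = 0`. [cite: SilvermanAEC2009, IV.7.5] -/
theorem torsionLift_eq_zero_of_mulP_eq_zero {R S : PowerSeries (EisensteinRoot.CoeffDisc D)}
    (hshape : W.formalMul p = (p : PowerSeries (EisensteinRoot.CoeffDisc D)) * PowerSeries.X * R + PowerSeries.X ^ (p ^ 2) * S)
    (hR : IsUnit (PowerSeries.constantCoeff R)) (hS : IsUnit (PowerSeries.constantCoeff S)) (he : D.e + 2 ≤ p ^ 2)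
    {t : ℕ → (maxNilIdealC F).toIdeal} (htp : ∀ n, mulPC W (t (n + 1)) = t n)
    (h : (mulP W ⟨torsionLift W hθ t htp, flim_mem_nilTheta _ _⟩ : AinfRamTop D) = 0) :
    torsionLift W hθ t htp = 0 :=
  eq_zero_of_mulP_eq_zero W hshape hR hS he h

end AinfRamTop

end Literature.NumberTheory.PAdicHodge

end
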